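import Summits.FinalStateConjecture.FinalStateConjecture.Theorems.PhaseMixingCaptureCaptureSufficesTameNoC0LimitCrossing
import Summits.FinalStateConjecture.FinalStateConjecture.Theorems.PhaseMixingCaptureCaptureSufficesTameNoC0LimitTail
import Summits.FinalStateConjecture.FinalStateConjecture.Theorems.PhaseMixingCaptureCaptureSufficesTameNoC0LocalNull
import HarnessLib

/-!
# NoC0KerrChart limit argument VI: the limit theorem (interface form)

Crux `CaptureSufficesTame` (stmt-FinalStateConjecture-17270), line `only-the-third-law-is-generic`, NoC0KerrChart programme,
lead c10. Registered sub-goal of this file: `stub_noC0_limitFalse` (`NoC0.noC0_limit_false`): no sequence of level-`n` causal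
structures `(B n, C n, O n)` on a relatively compact chunk `Ω` of the Kerr exterior (containing the `η₀`-tubes of one and a half
revolutions of the retrograde photon orbit and of the static segment at `p₀`) with `B n → g_{M,a}` can satisfy the conclusions
of the glue (`stub_noC0_glue`). Proof: packages at `p₀` (`stub_noC0_kerrNullNotChronological`, local closedness of `≤`), the
scale `tx`, `crossing_points`, generators through the anchors, ultralimits, `limit_tail`; the tube analysis is the hypothesis
landed `stub_noC0_tubeAnalysis`. References: O'Neill 1983, Ch. 10, Ch. 14 (key `ONeillSemiRiemannian1983`);
Sbierski, J. Diff. Geom. 108 (2018), §3 (key `Sbierski2016AHP`); Anal. PDE 8 (2015), §7A (key `Sbierski2015`).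
-/


set_option linter.dupNamespace false
set_option maxSynthPendingDepth 3

noncomputable section

open Set Filter Function Bundle MeasureTheory Metric
open scoped Manifold ContDiff Topology ENNReal

namespace Summit.FinalStateConjecture.FinalStateConjecture.Theorems.PhaseMixingCaptureCaptureSufficesTame

open Literature.Geometry.Lorentzian Literature.Geometry.Riemannian

namespace NoC0

set_option maxHeartbeats 800000 in
/-- **The limit argument of NoC0KerrChart (interface form).** No sequence of "level-`n` causal structures"
`(B n, C n, O n)` on a fixed relatively compact open chunk `Ω` of the Kerr exterior containing a tube around one
revolution of the retrograde photon orbit can satisfy simultaneously: `B n` is `ε n`-close to `g_{M,a}` on `Ω`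
with `ε n → 0`; `C n ⊇ O n` (closure / interior of the flat causal future of the base point `p₀ = γ(0)` at level
`n`) with push-up (H-D), `p₀ ∈ C n ∖ O n`, `t* ≥ 0` on `C n`, reachability of `C n` by `t*`-parametrised
`B n`-causal paths from `p₀`, and backward-lit boundary points (generators through boundary points close to
`p₀` coming from `p₀` and running inside `C n ∖ O n` until they leave every compact of `Ω`). See the module
docstring of the proof file for the argument (incidence; corner lemma against the known orbit; continuation along
an ultrafilter; the static timelike curve closes one revolution). [cite: ONeill1983, Ch. 10, Prop. 10.46; Ch. 14, Cor. 14.1] -/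
theorem noC0_limit_false (M a : ℝ) [Kerr.Facts] [Kerr.SliceFacts] (hM : 0 < M) (ha0 : 0 ≤ a) (haM : a ≤ M)
    (r₀ q e S : ℝ) (h3 : 3 * M ≤ r₀) (hcubic : r₀ * (r₀ - 3 * M) ^ 2 = 4 * a ^ 2 * M)
    (hq : q = √(M / r₀ ^ 3)) (he : e = 1 - a * q) (hS : S = 2 * Real.pi / q)
    (p₀ : E4) (hp₀ : p₀ = Kerr.orbitCurve a r₀ q 0)
    (Ω : Set E4) (hΩext : closure Ω ⊆ (Kerr.exterior M a : Set E4))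
    (hΩc : IsCompact (closure Ω)) (η₀ : ℝ) (hη₀ : 0 < η₀)
    (htube : cthickening η₀ (Kerr.orbitCurve a r₀ q '' Icc (-S) (2 * S)) ⊆ Ω)
    (hH : ∀ y ∈ cthickening η₀ (Kerr.orbitCurve a r₀ q '' Icc (-S) (2 * S)), Kerr.scalarH M a y ≤ 2 / 5)
    (hvert : cthickening η₀ ((fun w : ℝ ↦ p₀ + w • E4.basisVector 0) '' Icc 0 (2 * S)) ⊆ Ω)
    (d₁ : ℝ) (hd₁ : 0 < d₁)
    (ε : ℕ → ℝ) (hε0 : ∀ n, 0 ≤ ε n) (hε4 : ∀ n, ε n ≤ 1 / 80) (hε : Tendsto ε atTop (𝓝 0))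
    (B : ℕ → E4 → E4 →L[ℝ] E4 →L[ℝ] ℝ) (hB : ∀ n, ∀ y ∈ Ω, ‖B n y - Kerr.bilin M a y‖ ≤ ε n)
    (C O : ℕ → Set E4) (hOC : ∀ n, O n ⊆ C n) (hCΩ : ∀ n, C n ⊆ Ω) (hOo : ∀ n, IsOpen (O n))
    (hCcl : ∀ n, ∀ y ∈ Ω, y ∈ closure (C n) → y ∈ C n)
    (hD : ∀ n, ∀ y ∈ C n, ∀ z ∈ Ω, (∃ (c : ℝ → E4) (s₁ s₂ : ℝ), s₁ < s₂ ∧ c s₁ = y ∧ c s₂ = z ∧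
      ∀ t ∈ Icc s₁ s₂, c t ∈ Ω ∧ ∃ v : E4, HasDerivAt c v t ∧ B n (c t) v v < 0 ∧ 0 < v 0) → z ∈ O n)
    (hp : ∀ n, p₀ ∈ C n ∧ p₀ ∉ O n)
    (ht : ∀ n, ∀ y ∈ C n, p₀ 0 ≤ y 0)
    (hreach : ∀ n, ∀ y ∈ C n, ∀ δ > 0, ∃ y' ∈ Ω, ‖y' - y‖ < δ ∧ (y' = p₀ ∨ ∃ c : ℝ → E4, c (p₀ 0) = p₀ ∧
      c (y' 0) = y' ∧ p₀ 0 < y' 0 ∧ ∀ t ∈ Icc (p₀ 0) (y' 0), c t ∈ Ω ∧ c t 0 = t ∧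
        ∃ v : E4, HasDerivAt c v t ∧ B n (c t) v v ≤ 0 ∧ v 0 = 1))
    (hgen : ∀ n, ∀ x ∈ C n, x ∉ O n → x ≠ p₀ → x 0 < p₀ 0 + d₁ → ‖x - p₀‖ < d₁ →
      ∃ (μ : ℝ → E4) (E : ℝ), x 0 < E ∧ μ (p₀ 0) = p₀ ∧ μ (x 0) = x ∧
        (∀ t ∈ Ico (p₀ 0) E, μ t ∈ C n ∧ μ t ∉ O n ∧ μ t 0 = t ∧
          ∃ v : E4, HasDerivAt μ v t ∧ B n (μ t) v v ≤ 0 ∧ v 0 = 1) ∧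
        (∀ η > 0, ∀ t₀ < E, ∃ t, t₀ ≤ t ∧ p₀ 0 ≤ t ∧ t < E ∧ infDist (μ t) Ωᶜ < η)) :
    False := by
  subst hq
  subst hp₀
  haveI : Fact ((1 : ℕ∞ω) ≤ (∞ : ℕ∞ω)) := ⟨by exact_mod_cast le_top⟩
  haveI := LorentzianMetric.contMDiffCovariantDerivative_leviCivita_one (Kerr.smoothMetric M a (Kerr.rPlus M a))
  set τK := (Kerr.exteriorSpacetime M a hM.le).timeOrientation with hτK
  have hΩext' : Ω ⊆ (Kerr.exterior M a : Set E4) := subset_closure.trans hΩext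
  /- ═════════ 0. Orbit data ═════════ -/
  have hr₀ : 0 < r₀ := by linarith
  have hrp : Kerr.rPlus M a < r₀ := (Kerr.rPlus_le_two_mul hM.le).trans_lt (by linarith)
  have hmem : ∀ s, Kerr.orbitCurve a r₀ √(M / r₀ ^ 3) s ∈ Kerr.exterior M a := fun s ↦ by
    rw [Kerr.mem_exterior, Kerr.radius_orbitCurve hr₀]; exact max_lt hrp hr₀
  obtain ⟨-, -, hDL3, hTL, -, hINC⟩ := stub_noC0_tubeAnalysis
  obtain ⟨he0, he1, hq0', -⟩ := hINC M a r₀ (√(M / r₀ ^ 3)) e 1 0 hM ha0 haM h3 hcubic rfl he one_pos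
  have hS0 : 0 < S := by rw [hS]; positivity
  have htime : ∀ s, Kerr.orbitCurve a r₀ √(M / r₀ ^ 3) s 0 = e * s := fun s ↦ by
    rw [Kerr.orbitCurve_apply_zero, he]
  have he0x : ∀ t, Kerr.orbitCurve a r₀ √(M / r₀ ^ 3) (t / e) 0 = t := fun t ↦ by rw [htime]; field_simp
  have hp00 : Kerr.orbitCurve a r₀ √(M / r₀ ^ 3) 0 0 = 0 := by rw [htime, mul_zero]
  have hq2 : √(M / r₀ ^ 3) ^ 2 * r₀ ^ 3 = M := by
    rw [Real.sq_sqrt (by positivity)]; field_simp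
  have horbkin' := orbit_norm_sub_le' M a r₀ e hM ha0 h3 hcubic he he0
  have hcosne := orbit_apply_one_ne M a r₀ e S hM h3 hS he0
  have hΩnear : ∀ t z, 0 ≤ t → t ≤ 2 * (e * S) → ‖z - Kerr.orbitCurve a r₀ √(M / r₀ ^ 3) (t / e)‖ ≤ η₀ → z ∈ Ω :=
    fun t z ht0 htS hz ↦ htube (mem_orbitTube he0 hS0.le t z ht0 htS hz)
  /- ═════════ 1. The bundled exterior, local packages at `p₀`, the ultrafilter ═════════ -/
  set pK : Kerr.region a (Kerr.rPlus M a) := ⟨Kerr.orbitCurve a r₀ √(M / r₀ ^ 3) 0, hmem 0⟩ with hpK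
  -- (LC) no timelike curve near `p₀` from `p₀` to `exp_{p₀}(small null vector)`
  obtain ⟨W₁, V₁, hW₁o, hpW₁, hV₁, hLC⟩ := stub_noC0_kerrNullNotChronological M a hM.le pK
  -- local closedness of `≤`
  obtain ⟨W₂, hW₂o, hpW₂, hcl⟩ :=
    LorentzianMetric.exists_nhds_causalRelation_closed (g := Kerr.smoothMetric M a (Kerr.rPlus M a)) τK le_rfl pK
  obtain ⟨ρ, hρ, hρW⟩ : ∃ ρ > 0, ∀ y : Kerr.exterior M a,
      ‖(y : E4) - Kerr.orbitCurve a r₀ √(M / r₀ ^ 3) 0‖ < ρ → y ∈ W₁ ∧ y ∈ W₂ := by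
    obtain ⟨ρ₁, hρ₁, h₁⟩ := Metric.isOpen_iff.1 hW₁o pK hpW₁
    obtain ⟨ρ₂, hρ₂, h₂⟩ := Metric.isOpen_iff.1 hW₂o pK hpW₂
    refine ⟨min ρ₁ ρ₂, lt_min hρ₁ hρ₂, fun y hy ↦ ⟨h₁ ?_, h₂ ?_⟩⟩
    · rw [Metric.mem_ball]
      calc dist y pK = ‖(y : E4) - Kerr.orbitCurve a r₀ √(M / r₀ ^ 3) 0‖ := by
            change dist (y : E4) (pK : E4) = _; rw [dist_eq_norm]
        _ < ρ₁ := hy.trans_le (min_le_left _ _)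
    · rw [Metric.mem_ball]
      calc dist y pK = ‖(y : E4) - Kerr.orbitCurve a r₀ √(M / r₀ ^ 3) 0‖ := by
            change dist (y : E4) (pK : E4) = _; rw [dist_eq_norm]
        _ < ρ₂ := hy.trans_le (min_le_right _ _)
  -- the free ultrafilter along which all limits are taken
  set 𝒰 : Ultrafilter ℕ := hyperfilter ℕ with h𝒰def
  have h𝒰 : (𝒰 : Filter ℕ) ≤ atTop := by
    rw [← Nat.cofinite_eq_atTop]; exact hyperfilter_le_cofinite
  have hεU : Tendsto ε (𝒰 : Filter ℕ) (𝓝 0) := hε.mono_left h𝒰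
  have hlim : ∀ u : ℕ → E4, (∀ᶠ n in (𝒰 : Filter ℕ), u n ∈ closure Ω) →
      ∃ y ∈ closure Ω, Tendsto u (𝒰 : Filter ℕ) (𝓝 y) := by
    intro u hu
    have hle : ((𝒰.map u : Ultrafilter E4) : Filter E4) ≤ 𝓟 (closure Ω) := by
      rw [Ultrafilter.coe_map, le_principal_iff]; exact hu
    obtain ⟨y, hy, hle'⟩ := hΩc.ultrafilter_le_nhds (𝒰.map u) hle
    exact ⟨y, hy, hle'⟩
  have hlimR : ∀ (u : ℕ → ℝ) (A B : ℝ), (∀ᶠ n in (𝒰 : Filter ℕ), u n ∈ Icc A B) →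
      ∃ y ∈ Icc A B, Tendsto u (𝒰 : Filter ℕ) (𝓝 y) := by
    intro u A B hu
    have hle : ((𝒰.map u : Ultrafilter ℝ) : Filter ℝ) ≤ 𝓟 (Icc A B) := by
      rw [Ultrafilter.coe_map, le_principal_iff]; exact hu
    obtain ⟨y, hy, hle'⟩ := isCompact_Icc.ultrafilter_le_nhds (𝒰.map u) hle
    exact ⟨y, hy, hle'⟩
  have hcoord : Continuous fun z : E4 ↦ z 0 := (EuclideanSpace.proj (0 : Fin 4)).continuous
  /- ═════════ 2. The orbit as THE radial null geodesic from `p₀`; (LCx) ═════════ -/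
  set γK : ℝ → Kerr.region a (Kerr.rPlus M a) := fun s ↦ ⟨Kerr.orbitCurve a r₀ √(M / r₀ ^ 3) s, hmem s⟩ with hγK
  obtain ⟨-, -, hnull, -⟩ := kerr_orbitCurve_isGeodesic_null M a r₀ hM ha0 haM h3 hcubic hmem
  obtain ⟨ℓ, hℓ⟩ : ∃ ℓ : E4, velocity 𝓘(ℝ, E4) γK 0 = ℓ := ⟨_, rfl⟩
  have hexpΓ : ∀ s : ℝ, ((s • ℓ : E4) : TangentSpace 𝓘(ℝ, E4) pK) ∈
      expDomain (Kerr.smoothMetric M a (Kerr.rPlus M a)).leviCivita pK ∧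
      expMap (Kerr.smoothMetric M a (Kerr.rPlus M a)).leviCivita pK ((s • ℓ : E4) : TangentSpace 𝓘(ℝ, E4) pK) = γK s := by
    intro s
    have h := orbit_flow M a r₀ hM ha0 haM h3 hcubic hmem 0 s
    rw [zero_add, hℓ] at h
    exact h
  have key : ∀ (Φ : E4 →L[ℝ] E4 →L[ℝ] ℝ) (w : E4) (s : ℝ), Φ w w = 0 → Φ (s • w) (s • w) = 0 := by
    intro Φ w s h
    simp only [map_smul, smul_apply, h, smul_zero]
  have hℓnull : ∀ s : ℝ, s ≠ 0 →
      (Kerr.smoothMetric M a (Kerr.rPlus M a)).IsNull (x := pK) (s • ℓ) := by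
    intro s hs
    have h0 : (Kerr.smoothMetric M a (Kerr.rPlus M a)).IsNull (x := pK) ℓ := by rw [← hℓ]; exact hnull 0
    exact ⟨key _ ℓ s h0.1, smul_ne_zero hs h0.2⟩
  obtain ⟨rV, hrV, hballV⟩ := Metric.mem_nhds_iff.1 hV₁
  -- (LCx) small orbit points are NOT in the chronological future of `p₀`
  have hLCx : ∀ s : ℝ, 0 < s → ‖s • ℓ‖ < rV →
      ‖(γK s : E4) - Kerr.orbitCurve a r₀ √(M / r₀ ^ 3) 0‖ + 2 * |(γK s : E4) 0 - Kerr.orbitCurve a r₀ √(M / r₀ ^ 3) 0 0| < ρ →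
      (γK s) ∉ (Kerr.smoothMetric M a (Kerr.rPlus M a)).chronologicalFuture τK {pK} := by
    intro s hs hsV hsρ hchr
    obtain ⟨p', hp', α, t₁, t₂, ht12, hα, hαa, hαb⟩ := hchr
    have hp'' : p' = pK := hp'
    subst hp''
    have hmaps := causallyConvex_coordNhd (a := a) hM.le (Kerr.orbitCurve a r₀ √(M / r₀ ^ 3) 0) ρ α t₁ t₂ ht12.le
      hα.isFutureCausalCurveOn (by rw [hαa]; simp [hpK, hρ]) (by rw [hαb]; exact hsρ)
    have hαW : MapsTo α (Icc t₁ t₂) W₁ := fun t ht' ↦ by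
      have h := hmaps ht'
      simp only [mem_setOf_eq] at h
      exact (hρW (α t) (by linarith [abs_nonneg ((α t : E4) 0 - Kerr.orbitCurve a r₀ √(M / r₀ ^ 3) 0 0)])).1
    have hmemV : s • ℓ ∈ V₁ := hballV (by simpa using hsV)
    exact (hLC _ hmemV).2 (hℓnull s hs.ne') α t₁ t₂ ht12 hα hαW hαa (by rw [hαb]; exact (hexpΓ s).2.symm)
  /- ═════════ 3. The scale `tx` ═════════ -/
  obtain ⟨tx, htxdef⟩ : ∃ tx : ℝ, tx = min (min (η₀ / 10) (ρ / 40))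
      (min (min (e * S / 4) (d₁ / 8)) (rV * e / (2 * (‖ℓ‖ + 1)))) := ⟨_, rfl⟩
  have hℓ1 : 0 < ‖ℓ‖ + 1 := by positivity
  have htx : 0 < tx := by
    rw [htxdef]
    refine lt_min (lt_min (by positivity) (by positivity)) (lt_min (lt_min (by positivity) (by positivity)) ?_)
    positivity
  have h10 : 10 * tx ≤ η₀ := by
    have : tx ≤ η₀ / 10 := by rw [htxdef]; exact (min_le_left _ _).trans (min_le_left _ _)
    linarith
  have h40 : 40 * tx ≤ ρ := by
    have : tx ≤ ρ / 40 := by rw [htxdef]; exact (min_le_left _ _).trans (min_le_right _ _)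
    linarith
  have h4S : 4 * tx ≤ e * S := by
    have : tx ≤ e * S / 4 := by rw [htxdef]; exact (min_le_right _ _).trans ((min_le_left _ _).trans (min_le_left _ _))
    linarith
  have h8d : 8 * tx ≤ d₁ := by
    have : tx ≤ d₁ / 8 := by rw [htxdef]; exact (min_le_right _ _).trans ((min_le_left _ _).trans (min_le_right _ _))
    linarith
  have hℓtx : tx / e * ‖ℓ‖ < rV := by
    have h1 : tx ≤ rV * e / (2 * (‖ℓ‖ + 1)) := by rw [htxdef]; exact (min_le_right _ _).trans (min_le_right _ _)
    have h2 : tx / e ≤ rV / (2 * (‖ℓ‖ + 1)) := by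
      rw [div_le_iff₀ he0]
      calc tx ≤ rV * e / (2 * (‖ℓ‖ + 1)) := h1
        _ = rV / (2 * (‖ℓ‖ + 1)) * e := by ring
    calc tx / e * ‖ℓ‖ ≤ rV / (2 * (‖ℓ‖ + 1)) * ‖ℓ‖ := by gcongr
      _ < rV := by
        rw [div_mul_eq_mul_div, div_lt_iff₀ (by positivity)]
        nlinarith [norm_nonneg ℓ]
  /- ═════════ 4. Crossing points on `(0, tx]` ═════════ -/
  have hcp : ∀ s ∈ Ioc 0 tx, ∃ x : ℕ → E4, (∀ᶠ n in (𝒰 : Filter ℕ), x n ∈ C n ∧ x n ∉ O n ∧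
      ∃ u ∈ Icc (-s) s, x n = Kerr.orbitCurve a r₀ √(M / r₀ ^ 3) (s / e) + u • E4.basisVector 0) ∧
      Tendsto x (𝒰 : Filter ℕ) (𝓝 (Kerr.orbitCurve a r₀ √(M / r₀ ^ 3) (s / e))) := by
    intro s hs
    refine crossing_points M a hM ha0 haM r₀ (√(M / r₀ ^ 3)) e S h3 hcubic rfl he hS he0 hq0' _ rfl Ω hΩext η₀ hη₀
      htube hH 𝒰 h𝒰 ε hε0 hε4 hεU B hB C O hOC hOo hCcl hD hp ht hreach W₂ hcl ρ hρ
      (fun y hy ↦ (hρW y hy).2) s hs.1 (by linarith [hs.2]) (by linarith [hs.2]) (by linarith [hs.2]) ?_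
    intro h₁ h₂
    refine hLCx (s / e) (by have := hs.1; positivity) ?_ ?_
    · rw [norm_smul, Real.norm_eq_abs, abs_of_pos (by have := hs.1; positivity)]
      calc s / e * ‖ℓ‖ ≤ tx / e * ‖ℓ‖ := by gcongr; exact hs.2
        _ < rV := hℓtx
    · change ‖Kerr.orbitCurve a r₀ √(M / r₀ ^ 3) (s / e) - Kerr.orbitCurve a r₀ √(M / r₀ ^ 3) 0‖ +
        2 * |Kerr.orbitCurve a r₀ √(M / r₀ ^ 3) (s / e) 0 - Kerr.orbitCurve a r₀ √(M / r₀ ^ 3) 0 0| < ρ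
      rw [he0x, hp00, sub_zero, abs_of_pos hs.1]
      have := horbkin' 0 s hs.1.le
      rw [zero_div] at this
      linarith [hs.2]
  choose! xs hxs hxslim using hcp
  /- ═════════ 5. The generators through `x_n := xs tx n` ═════════ -/
  have htxI : tx ∈ Ioc 0 tx := ⟨htx, le_rfl⟩
  have hne0 : ‖E4.basisVector 0‖ = 1 := by simp [E4.basisVector]
  have hb1 : (E4.basisVector 0 : E4) 1 = 0 := by simp [E4.basisVector]
  have hb0 : (E4.basisVector 0 : E4) 0 = 1 := by simp [E4.basisVector]
  have H8 : ∀ᶠ n in (𝒰 : Filter ℕ), ∃ (μ : ℝ → E4) (E : ℝ), xs tx n 0 < E ∧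
      μ 0 = Kerr.orbitCurve a r₀ √(M / r₀ ^ 3) 0 ∧ μ (xs tx n 0) = xs tx n ∧
      (∀ t ∈ Ico 0 E, μ t ∈ C n ∧ μ t ∉ O n ∧ μ t 0 = t ∧
        ∃ v : E4, HasDerivAt μ v t ∧ B n (μ t) v v ≤ 0 ∧ v 0 = 1) ∧
      (∀ η > 0, ∀ t₀ < E, ∃ t, t₀ ≤ t ∧ 0 ≤ t ∧ t < E ∧ infDist (μ t) Ωᶜ < η) := by
    filter_upwards [hxs tx htxI] with n hn
    obtain ⟨hC, hO, u, huI, hxu⟩ := hn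
    have hx0 : xs tx n 0 = tx + u := by
      rw [hxu]
      rw [show (Kerr.orbitCurve a r₀ √(M / r₀ ^ 3) (tx / e) + u • E4.basisVector 0) 0 =
        Kerr.orbitCurve a r₀ √(M / r₀ ^ 3) (tx / e) 0 + u * (E4.basisVector 0 : E4) 0 from rfl, he0x, hb0, mul_one]
    have hne : xs tx n ≠ Kerr.orbitCurve a r₀ √(M / r₀ ^ 3) 0 := by
      intro h
      have h1 := congrArg (fun z : E4 ↦ z 1) h
      simp only at h1
      rw [hxu, show (Kerr.orbitCurve a r₀ √(M / r₀ ^ 3) (tx / e) + u • E4.basisVector 0) 1 =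
        Kerr.orbitCurve a r₀ √(M / r₀ ^ 3) (tx / e) 1 + u * (E4.basisVector 0 : E4) 1 from rfl, hb1, mul_zero,
        add_zero] at h1
      exact hcosne tx htx (by linarith) h1
    have hlt : xs tx n 0 < Kerr.orbitCurve a r₀ √(M / r₀ ^ 3) 0 0 + d₁ := by
      rw [hp00, hx0]; linarith [huI.2]
    have hnorm : ‖xs tx n - Kerr.orbitCurve a r₀ √(M / r₀ ^ 3) 0‖ < d₁ := by
      rw [hxu]
      calc ‖Kerr.orbitCurve a r₀ √(M / r₀ ^ 3) (tx / e) + u • E4.basisVector 0 - Kerr.orbitCurve a r₀ √(M / r₀ ^ 3) 0‖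
          ≤ ‖Kerr.orbitCurve a r₀ √(M / r₀ ^ 3) (tx / e) - Kerr.orbitCurve a r₀ √(M / r₀ ^ 3) 0‖ + ‖u • E4.basisVector 0‖ := by
            rw [add_sub_right_comm]; exact norm_add_le _ _
        _ ≤ 2 * tx + tx := by
            gcongr
            · have := horbkin' 0 tx htx.le; rwa [zero_div, sub_zero] at this
            · rw [norm_smul, hne0, mul_one, Real.norm_eq_abs, abs_le]; exact ⟨by linarith [huI.1], huI.2⟩
        _ < d₁ := by linarith
    have h := hgen n (xs tx n) hC hO hne hlt hnorm
    rw [hp00] at h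
    exact h
  obtain ⟨U₈, hU₈, hU₈spec⟩ := H8.exists_mem
  choose! μ E hE hμ0 hμx hμgen hexit using hU₈spec
  have hU₈ev : ∀ᶠ n in (𝒰 : Filter ℕ), n ∈ U₈ := hU₈
  -- kinematics of the generators (K3), symmetric form
  have hμK3 : ∀ n ∈ U₈, ∀ t₁ t₂, 0 ≤ t₁ → t₁ ≤ t₂ → t₂ < E n → ‖μ n t₂ - μ n t₁‖ ≤ 2 * (t₂ - t₁) := by
    intro n hn t₁ t₂ h1 h12 h2
    have h := (kerr_time_strictMonoOn_and_norm_sub_le M a (fun s ↦ B n (μ n s)) (μ n) t₁ t₂ hM.le h12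
      (fun s' hs' ↦ ?_)).2
    · rw [(hμgen n hn t₂ ⟨by linarith, h2⟩).2.2.1, (hμgen n hn t₁ ⟨h1, by linarith⟩).2.2.1] at h
      exact h
    · obtain ⟨hCs, -, -, v, hv, hBv, hv0⟩ := hμgen n hn s' ⟨by linarith [hs'.1], by linarith [hs'.2]⟩
      exact ⟨(hB n _ (hCΩ n hCs)).trans (by linarith [hε4 n]), v, hv, hBv, by rw [hv0]; exact one_pos⟩
  have hμK3' : ∀ n ∈ U₈, ∀ t₁ t₂, 0 ≤ t₁ → t₁ < E n → 0 ≤ t₂ → t₂ < E n → ‖μ n t₂ - μ n t₁‖ ≤ 2 * |t₂ - t₁| := by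
    intro n hn t₁ t₂ h1 h1E h2 h2E
    rcases le_total t₁ t₂ with h | h
    · rw [abs_of_nonneg (by linarith)]; exact hμK3 n hn t₁ t₂ h1 h h2E
    · rw [abs_of_nonpos (by linarith), norm_sub_rev]
      have := hμK3 n hn t₂ t₁ h2 h h1E
      linarith
  /- ═════════ 6. The exit-time limit `EU` and the limit curve `y` ═════════ -/
  have hxs0 : Tendsto (fun n ↦ xs tx n 0) (𝒰 : Filter ℕ) (𝓝 tx) := by
    have := (hcoord.tendsto _).comp (hxslim tx htxI)
    simpa [Function.comp_def, he0x] using this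
  obtain ⟨EU, hEUI, hEU⟩ : ∃ EU ∈ Icc 0 (2 * (e * S)),
      Tendsto (fun n ↦ min (E n) (2 * (e * S))) (𝒰 : Filter ℕ) (𝓝 EU) := by
    refine hlimR _ _ _ ?_
    filter_upwards [hU₈ev, hxs tx htxI] with n hn hn'
    obtain ⟨hC, -, u, huI, hxu⟩ := hn'
    refine ⟨le_min ?_ (by positivity), min_le_right _ _⟩
    have h1 := hE n hn
    have h2 := ht n _ hC
    rw [hp00] at h2
    linarith
  have hEev : ∀ t, t < EU → ∀ᶠ n in (𝒰 : Filter ℕ), t < E n := fun t htl ↦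
    (hEU.eventually (lt_mem_nhds htl)).mono fun n hn ↦ lt_of_lt_of_le hn (min_le_left _ _)
  have hEUtx : tx ≤ EU := by
    have h1 : Tendsto (fun n ↦ min (xs tx n 0) (2 * (e * S))) (𝒰 : Filter ℕ) (𝓝 (min tx (2 * (e * S)))) :=
      hxs0.min tendsto_const_nhds
    have h2 : min tx (2 * (e * S)) = tx := min_eq_left (by linarith)
    rw [h2] at h1
    refine le_of_tendsto_of_tendsto h1 hEU ?_
    filter_upwards [hU₈ev] with n hn
    exact min_le_min (hE n hn).le le_rfl
  have hy_ex : ∀ t, ∃ Y : E4, (0 ≤ t ∧ t < EU) → Tendsto (fun n ↦ μ n t) (𝒰 : Filter ℕ) (𝓝 Y) := by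
    intro t
    by_cases htc : 0 ≤ t ∧ t < EU
    · obtain ⟨Y, -, hY⟩ := hlim (fun n ↦ μ n t) (by
        filter_upwards [hU₈ev, hEev t htc.2] with n hn hnE
        exact subset_closure (hCΩ n (hμgen n hn t ⟨htc.1, hnE⟩).1))
      exact ⟨Y, fun _ ↦ hY⟩
    · exact ⟨Kerr.orbitCurve a r₀ √(M / r₀ ^ 3) 0, fun h ↦ absurd h htc⟩
  choose y hy using hy_ex
  have hytx : tx < EU → y tx = Kerr.orbitCurve a r₀ √(M / r₀ ^ 3) (tx / e) := by
    intro htxE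
    refine tendsto_nhds_unique (hy tx ⟨htx.le, htxE⟩) ?_
    -- `μ n tx - xs tx n → 0` and `xs tx n → Γ tx`
    have h1 : Tendsto (fun n ↦ μ n tx - xs tx n) (𝒰 : Filter ℕ) (𝓝 0) := by
      rw [tendsto_zero_iff_norm_tendsto_zero]
      have h2 : Tendsto (fun n ↦ 2 * |tx - xs tx n 0|) (𝒰 : Filter ℕ) (𝓝 0) := by
        have := ((tendsto_const_nhds (x := tx)).sub hxs0).abs.const_mul 2
        simpa using this
      refine squeeze_zero' (Eventually.of_forall fun n ↦ norm_nonneg _) ?_ h2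
      filter_upwards [hU₈ev, hEev tx htxE, hxs tx htxI] with n hn hnE hn'
      obtain ⟨hC, -, u, huI, hxu⟩ := hn'
      have hx0' : 0 ≤ xs tx n 0 := by have := ht n _ hC; rwa [hp00] at this
      have hK := hμK3' n hn (xs tx n 0) tx hx0' (hE n hn) htx.le hnE
      rw [hμx n hn] at hK
      exact hK
    have := h1.add (hxslim tx htxI)
    simpa using this
  /- ═════════ 7–9. The tail: identification, no early exit, one period ═════════ -/
  exact limit_tail M a hM ha0 haM r₀ e S h3 hcubic he hS he0 he1 hq0' Ω hΩext hΩc η₀ hη₀ htube hH hvert hDL3 hTL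
    𝒰 ε hε0 hε4 hεU B hB C O hCΩ hD hp ht tx htx h4S xs hxs hxslim μ E U₈ hU₈ev hE hμx hμgen hexit EU hEU hEUtx y hy hytx

end NoC0

/-- **Registered sub-goal `stub_noC0_limitFalse`** (NoC0KerrChart programme, crux `CaptureSufficesTame`, line
`only-the-third-law-is-generic`): the limit theorem of NoC0KerrChart in interface form (`NoC0.noC0_limit_false`), verbatim. [cite: ONeillSemiRiemannian1983, Ch. 14, Lemma 14.2] -/
theorem stub_noC0_limitFalse :
    ∀ (M a : ℝ), ∀ [Kerr.Facts], ∀ [Kerr.SliceFacts], (0 < M) → (0 ≤ a) → (a ≤ M) → ∀ (r₀ q e S : ℝ), (3 * M ≤ r₀) → (r₀ * (r₀ - 3 * M) ^ 2 = 4 * a ^ 2 * M) → (q = √(M / r₀ ^ 3)) → (e = 1 -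
      a * q) → (S = 2 * Real.pi / q) → ∀ (p₀ : E4), (p₀ = Kerr.orbitCurve a r₀ q 0) → ∀ (Ω : Set E4), (closure Ω ⊆ (Kerr.exterior M a : Set E4)) → (IsCompact (closure Ω)) → ∀ (η₀ : ℝ), (0 <
      η₀) → (cthickening η₀ (Kerr.orbitCurve a r₀ q '' Icc (-S) (2 * S)) ⊆ Ω) → (∀ y ∈ cthickening η₀ (Kerr.orbitCurve a r₀ q '' Icc (-S) (2 * S)), Kerr.scalarH M a y ≤ 2 / 5) → (cthickening
      η₀ ((fun w : ℝ ↦ p₀ + w • E4.basisVector 0) '' Icc 0 (2 * S)) ⊆ Ω) → ∀ (d₁ : ℝ), (0 < d₁) → ∀ (ε : ℕ → ℝ), (∀ n, 0 ≤ ε n) → (∀ n, ε n ≤ 1 / 80) → (Tendsto ε atTop (𝓝 0)) → ∀ (B : ℕ →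
      E4 → E4 →L[ℝ] E4 →L[ℝ] ℝ), (∀ n, ∀ y ∈ Ω, ‖B n y - Kerr.bilin M a y‖ ≤ ε n) → ∀ (C O : ℕ → Set E4), (∀ n, O n ⊆ C n) → (∀ n, C n ⊆ Ω) → (∀ n, IsOpen (O n)) → (∀ n, ∀ y ∈ Ω, y ∈ closure
      (C n) → y ∈ C n) → (∀ n, ∀ y ∈ C n, ∀ z ∈ Ω, (∃ (c : ℝ → E4) (s₁ s₂ : ℝ), s₁ < s₂ ∧ c s₁ = y ∧ c s₂ = z ∧ ∀ t ∈ Icc s₁ s₂, c t ∈ Ω ∧ ∃ v : E4, HasDerivAt c v t ∧ B n (c t) v v < 0 ∧ 0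
      < v 0) → z ∈ O n) → (∀ n, p₀ ∈ C n ∧ p₀ ∉ O n) → (∀ n, ∀ y ∈ C n, p₀ 0 ≤ y 0) → (∀ n, ∀ y ∈ C n, ∀ δ > 0, ∃ y' ∈ Ω, ‖y' - y‖ < δ ∧ (y' = p₀ ∨ ∃ c : ℝ → E4, c (p₀ 0) = p₀ ∧ c (y' 0) =
      y' ∧ p₀ 0 < y' 0 ∧ ∀ t ∈ Icc (p₀ 0) (y' 0), c t ∈ Ω ∧ c t 0 = t ∧ ∃ v : E4, HasDerivAt c v t ∧ B n (c t) v v ≤ 0 ∧ v 0 = 1)) → (∀ n, ∀ x ∈ C n, x ∉ O n → x ≠ p₀ → x 0 < p₀ 0 + d₁ → ‖x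
      - p₀‖ < d₁ → ∃ (μ : ℝ → E4) (E : ℝ), x 0 < E ∧ μ (p₀ 0) = p₀ ∧ μ (x 0) = x ∧ (∀ t ∈ Ico (p₀ 0) E, μ t ∈ C n ∧ μ t ∉ O n ∧ μ t 0 = t ∧ ∃ v : E4, HasDerivAt μ v t ∧ B n (μ t) v v ≤ 0 ∧ v
      0 = 1) ∧ (∀ η > 0, ∀ t₀ < E, ∃ t, t₀ ≤ t ∧ p₀ 0 ≤ t ∧ t < E ∧ infDist (μ t) Ωᶜ < η)) → False :=
  NoC0.noC0_limit_false

end Summit.FinalStateConjecture.FinalStateConjecture.Theorems.PhaseMixingCaptureCaptureSufficesTame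

end
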